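import Summits.ValiantsHypothesis.ValiantsHypothesis.Theorems.OrderedCountWindow
import Literature.Computability.AlgebraicComplexity.PBoundedGrowth
import HarnessLib
import HarnessLib.Audit

/-!
# OrderedCountWindowRungs — the dial `A_t = PerNotSumOrdered t` and its decided rungs
(decomp-valiant lens 6, gen 6; companion of `Theorems.OrderedCountWindow`, which proves the kernel bound
`2^{⌊⌊n/2⌋/t⌋} ≤ total width`)

## Pieces and tags (workshop output contract)

* `PerNotSumOrdered t` (`A_t`, `@[conjecture]`, i.o. form as `DecompCycle1.PerNotSmVP`): for every
  exponent `c` some `per_n` is not a sum of `t n` ordered set-multilinear ABPs of total width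
  `≤ n^c + c` over `ℂ`.  TAG WEAKER than `S = VP ≠ VNP` (necessity `S → A_t` for EVERY `t`:
  `OrderedCountWindowNecessity.perNotSumOrdered_of_vh`, kernel); DECIDED here for `t` constant
  (`perNotSumOrdered_const`; `t = 1` is Nisan 1991 = the gen-4 rung, `isSumOrdered_one_iff`) and
  `t = ⌊√n⌋` (`perNotSumOrdered_sqrt`, Arvind–Raja's printed regime `n^{1/2-ε}`), and in general for
  every `t` with `n ↦ 2^{⌊n/2⌋/t n}` not p-bounded (`perNotSumOrdered_of_not_isPBounded`), i.e. all
  `t = o(n / log n)`; OPEN — the ATTACKABLE leaf, the window — for `n / log n ≲ t ≤ poly(n)`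
  [cite: ChatterjeeKushSarafShpilka2024, §1.2, Thm 1, Thm 3]; antitone in `t` (`PerNotSumOrdered.anti`).
* The exact residual `B_t := A_t → S` is zero-sum (workshop LESSON 6) and is not filed.

[cite: ArvindRaja2016, Cor 12] [cite: ChatterjeeKushSarafShpilka2024, §1.2] [cite: Nisan1991Noncommutative, §4]
-/

noncomputable section

namespace Summit.ValiantsHypothesis.ValiantsHypothesis.Theorems.OrderedCountWindow

open Literature.Computability.AlgebraicComplexity Matrix

variable {F : Type*} [Field F]

/-! ## §1 Padding, and the bottom rung `t = 1` -/

/-- A program of width `0` computes the zero tensor. [folklore] -/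
theorem eq_zero_of_hasNcABPWidthLE_zero {d m : ℕ} {Ψ : (Fin d → Fin m) → F}
    (h : BDI2020.HasNcABPWidthLE 0 Ψ) : Ψ = 0 := by
  obtain ⟨C, u, v, hC⟩ := h
  funext i
  rw [hC i]
  simp [dotProduct]

/-- The zero tensor has a program of every width. [folklore] -/
theorem hasNcABPWidthLE_zero (w : ℕ) {d m : ℕ} :
    BDI2020.HasNcABPWidthLE w (0 : (Fin d → Fin m) → F) :=
  ⟨fun _ _ => 0, 0, 0, fun i => by simp⟩

/-- Monotonicity in the number of summands (pad with width-`0` programs). [folklore] -/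
theorem IsSumOrdered.mono_count {n t t' W : ℕ} (h : IsSumOrdered F n t W) (ht : t ≤ t') :
    IsSumOrdered F n t' W := by
  obtain ⟨σ, w, B, hB, hsum, hper⟩ := h
  obtain ⟨d, rfl⟩ := Nat.exists_eq_add_of_le ht
  refine ⟨Fin.append σ (fun _ => 1), Fin.append w (fun _ => 0), Fin.append B (fun _ => 0),
    fun i => ?_, ?_, fun J => ?_⟩
  · refine Fin.addCases (motive := fun i => BDI2020.HasNcABPWidthLE (Fin.append w (fun _ => 0) i)
      (Fin.append B (fun _ => (0 : (Fin n → Fin n) → F)) i)) (fun i => ?_) (fun i => ?_) i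
    · simpa only [Fin.append_left] using hB i
    · simpa only [Fin.append_right] using hasNcABPWidthLE_zero (F := F) 0
  · rw [Fin.sum_univ_add]
    simpa only [Fin.append_left, Fin.append_right, Finset.sum_const_zero, add_zero] using hsum
  · rw [Fin.sum_univ_add]
    simp only [Fin.append_left, Fin.append_right, Pi.zero_apply, Finset.sum_const_zero, add_zero]
    exact hper J

/-- `t = 1` is exactly Nisan's noncommutative ABP (one block order; the word tensor of `per` is
invariant under reordering the columns), so the bottom rung of the dial is the gen-4 decided rung:
minimal total width `C(n, ⌊n/2⌋)`. [cite: Nisan1991Noncommutative, §4] -/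
theorem isSumOrdered_one_iff (n W : ℕ) : IsSumOrdered F n 1 W ↔ n.choose (n / 2) ≤ W := by
  constructor
  · rintro ⟨σ, w, B, hB, hsum, hper⟩
    have hB0 : B 0 = NisanPermanent.perWord F n := by
      funext K
      have h := hper (K ∘ ⇑(σ 0).symm)
      rw [Fin.sum_univ_one] at h
      have hK : (K ∘ ⇑(σ 0).symm) ∘ ⇑(σ 0) = K := by
        funext p; simp
      rw [hK] at h
      rw [h]
      by_cases hKi : Function.Injective K
      · simp [NisanPermanent.perWord, hKi, (σ 0).symm.injective]
      · simp [NisanPermanent.perWord, hKi]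
    have h0 := hB 0
    rw [hB0, NisanPermanent.hasNcABPWidthLE_perWord_iff] at h0
    refine h0.trans (le_trans ?_ hsum)
    rw [Fin.sum_univ_one]
  · intro h
    refine ⟨fun _ => 1, fun _ => W, fun _ => NisanPermanent.perWord F n, fun _ => ?_, by simp, fun J => ?_⟩
    · exact (NisanPermanent.hasNcABPWidthLE_perWord_iff (F := F) n W).2 h
    · simp

/-! ## §2 The dial `A_t` and its decided rungs -/

/-- **`A_t` — PIECE of the ordered-count window (i.o. form, as `DecompCycle1.PerNotSmVP`)**: for every
exponent `c` there is an `n` such that `per_n` is NOT a sum of `t n` ordered set-multilinear ABPs (in any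
block orders) of total width `≤ n^c + c` over `ℂ`.  TAG WEAKER than `VP ≠ VNP` (necessity: sibling file
`OrderedCountWindowNecessity`); DECIDED for `t = o(n / log n)` (below); OPEN for
`n / log n ≲ t ≤ poly(n)` — the window. [cite: ArvindRaja2016, Cor 12] [cite: ChatterjeeKushSarafShpilka2024, §1.2] -/
@[conjecture] def PerNotSumOrdered (t : ℕ → ℕ) : Prop :=
  ∀ c : ℕ, ∃ n : ℕ, ¬ IsSumOrdered ℂ n (t n) (n ^ c + c)

/-- The dial is antitone: allowing more summands is a weaker restriction. [folklore] -/
theorem PerNotSumOrdered.anti {t t' : ℕ → ℕ} (h : ∀ n, t n ≤ t' n) (hA : PerNotSumOrdered t') :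
    PerNotSumOrdered t := by
  intro c
  obtain ⟨n, hn⟩ := hA c
  exact ⟨n, fun hS => hn (hS.mono_count (h n))⟩

/-- **Growth form of the rung**: `A_t` holds as soon as `n ↦ 2^{⌊n/2⌋/t n}` is not p-bounded (every
`t = o(n / log n)`). [cite: ArvindRaja2016, Cor 12] -/
theorem perNotSumOrdered_of_not_isPBounded {t : ℕ → ℕ}
    (h : ¬ IsPBounded fun n => 2 ^ (n / 2 / t n)) : PerNotSumOrdered t := by
  intro c
  by_contra hc
  push Not at hc
  exact h ⟨c, fun n => two_pow_le_of_isSumOrdered (hc n)⟩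

/-- **Rung: constant support** (`t n = k`; for `k = 1` this is Nisan 1991). [cite: ArvindRaja2016, Cor 12] -/
theorem perNotSumOrdered_const (k : ℕ) : PerNotSumOrdered fun _ => k := by
  rcases Nat.eq_zero_or_pos k with rfl | hk
  · exact fun c => ⟨0, fun h => absurd h.pos (lt_irrefl 0)⟩
  refine perNotSumOrdered_of_not_isPBounded fun hP => ?_
  have hlin : IsPBounded fun N => 2 * k * N :=
    IsPBounded.mul_holds (IsPBounded.const (2 * k)) IsPBounded.id
  have hc := IsPBounded.comp_holds hP hlin
  refine not_isPBounded_two_pow (hc.mono fun N => le_of_eq ?_)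
  have hN : 2 * k * N / 2 / k = N := by
    rw [Nat.mul_assoc, Nat.mul_div_cancel_left _ (by norm_num : 0 < 2), Nat.mul_div_cancel_left _ hk]
  simp only [hN]

/-- **Rung: support `⌊√n⌋`** (Arvind–Raja's printed regime `n^{1/2-ε}`, here with the explicit bound
`2^{⌊n/2⌋/⌊√n⌋}`). [cite: ArvindRaja2016, Cor 12] -/
theorem perNotSumOrdered_sqrt : PerNotSumOrdered Nat.sqrt := by
  refine perNotSumOrdered_of_not_isPBounded fun hP => ?_
  have h2 : IsPBounded fun N => 2 * N := IsPBounded.mul_holds (IsPBounded.const 2) IsPBounded.id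
  have hsq : IsPBounded fun N => (2 * N) ^ 2 := IsPBounded.pow_holds h2 2
  have hc := IsPBounded.comp_holds hP hsq
  refine not_isPBounded_two_pow (hc.mono fun N => le_of_eq ?_)
  have hN : (2 * N) ^ 2 / 2 / Nat.sqrt ((2 * N) ^ 2) = N := by
    rw [Nat.sqrt_eq']
    rcases Nat.eq_zero_or_pos N with rfl | hN
    · simp
    · have h1 : (2 * N) ^ 2 / 2 = 2 * N * N := by
        rw [show (2 * N) ^ 2 = 2 * (2 * N * N) by ring]
        exact Nat.mul_div_cancel_left _ (by norm_num)
      rw [h1]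
      exact Nat.mul_div_cancel_left N (by omega)
  simp only [hN]

end Summit.ValiantsHypothesis.ValiantsHypothesis.Theorems.OrderedCountWindow
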